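import Summits.AnomalousDissipation.AnomalousDissipation.Theorems.ImpulseGridGridInjectionIdentity

/-!
# Line `Sketch` for crux `GridSignsLaw` (item stmt-AnomalousDissipation-14349, route ImpulseGrid) —
stub `stub_profileFluxLaw`: the streamwise profile flux law of the imprint, tested form

For the slab⊗transverse force `Φ•G` (`G` smooth, `x₀`-invariant, `G₀ ≡ 0`, divergence free),
every smooth weight `ρ` depending on `x₀` only, any constant `c` (`w := u − c e₀`) and every
global Leray–Hopf solution with a sup-energy bound, in every generalized long-time limit `Λ`:

`c·Λ⟨(∂₀ρ•G, u)⟩ + Λ⟨∫⟪w,(w·∇)(ρ•G)⟫⟩ + νΛ⟨(u,Δ(ρ•G))⟩ + ∫Φρ‖G‖² = 0`.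

This is the mean momentum balance (`meanMomentumBalance_proof`, item stmt-AnomalousDissipation-1773,
file `ImpulseGridMeanMomentumBalance`) tested with the divergence-free field `ρ•G`
(`GridInjection.isDivFree_smul_of_design`), after the pointwise algebra
`⟪u,(u·∇)(ρG)⟫ = ⟪w,(w·∇)(ρG)⟫ + c ∂₀ρ ⟪u,G⟫` (`GridInjection.integral_inner_convect_eq_shift`
with `θ = ∂₀ρ`; `∂₀(ρ•G) = ∂₀ρ•G` because `∂₀G = 0`), the force pairing `⟪Φ•G,ρ•G⟫ = Φρ‖G‖²`,
and linearity of `Λ⟨·⟩ = Λ ∘ timeMean` on pieces that are interval integrable on every `[0, T]`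
(`GridInjection.longTimeAvg_add`, `GridInjection.longTimeAvg_const_mul`). It is the `x₀`-moment
hierarchy of the imprint: `ρ = Ψ` with `∂₀Ψ = Φ − 1` is conjunct (1) of
`impulseGrid_gridInjectionIdentity`, `ρ = 1` is conjunct (2). No Fubini or slicing in `x₀` is used;
no new definitions.

References: Foias–Manley–Rosa–Temam 2001, Ch. IV §3.1; Doering–Foias 2002 §2 (bookkeeping of
body-forced Navier–Stokes in generalized limits).
-/

noncomputable section

-- `Summit.<Summit>.<Problem>` is the tree's mandated summit-side namespace (CONVENTIONS §2); for this
-- single-conjunct summit the two coincide, so the duplicate is deliberate.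
set_option linter.dupNamespace false

open MeasureTheory Set Filter Topology
open scoped InnerProductSpace RealInnerProductSpace

namespace Summit.AnomalousDissipation.AnomalousDissipation.Theorems

open Literature.Analysis.FluidPDE Literature.Analysis.FluidPDE.Torus
open Literature.Analysis.FunctionSpaces Literature.Analysis.FunctionSpaces.Torus

local notation "𝕋³" => UnitAddTorus (Fin 3)
local notation "E³" => EuclideanSpace ℝ (Fin 3)

/-- **Stub `stub_profileFluxLaw` of line `Sketch` (crux `GridSignsLaw`,
stmt-AnomalousDissipation-14349; card `mean-wake-quadrant`, second stub `ProfileFluxLaw`): the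
streamwise profile flux law of the imprint, tested form.** For the slab⊗transverse force `Φ•G`
(`G` smooth, `x₀`-invariant, `G₀ ≡ 0`, divergence free), every smooth weight `ρ` depending on `x₀`
only, any constant `c` (`w := u − c e₀`) and every global Leray–Hopf solution with a sup-energy
bound: `c·Λ⟨(∂₀ρ•G, u)⟩ + Λ⟨∫⟪w,(w·∇)(ρ•G)⟫⟩ + νΛ⟨(u,Δ(ρ•G))⟩ + ∫Φρ‖G‖² = 0`.
It is the mean momentum balance (`meanMomentumBalance_proof`, item stmt-AnomalousDissipation-1773)
at the admissible test field `ρ•G` (`GridInjection.isDivFree_smul_of_design`) plus the pointwise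
algebra `⟪u,(u·∇)(ρG)⟫ = ⟪w,(w·∇)(ρG)⟫ + c ∂₀ρ ⟪u,G⟫` (`GridInjection.integral_inner_convect_eq_shift`
with `θ = ∂₀ρ`, `∂₀(ρG) = ∂₀ρ•G` since `∂₀G = 0`), the force pairing `⟪Φ•G,ρ•G⟫ = Φρ‖G‖²` and
linearity of generalized long-time averages on interval-integrable pieces; `ρ = Ψ` (with
`∂₀Ψ = Φ − 1`) is conjunct (1) of `impulseGrid_gridInjectionIdentity`, `ρ = 1` conjunct (2)
(Foias–Manley–Rosa–Temam 2001, Ch. IV §3.1; Doering–Foias 2002 §2). [folklore] -/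
theorem stub_profileFluxLaw :
    ∀ (Λ : GeneralizedLimit) (ν c : ℝ) (Φ ρ : 𝕋³ → ℝ) (G : 𝕋³ → E³) (u₀ : 𝕋³ → E³)
      (u : ℝ → 𝕋³ → E³),
      0 < ν → IsSmooth Φ → IsSmooth ρ → IsSmooth G →
      (∀ (s : UnitAddCircle) x, ρ (x + Pi.single (1 : Fin 3) s) = ρ x ∧
        ρ (x + Pi.single (2 : Fin 3) s) = ρ x) →
      (∀ (s : UnitAddCircle) x, G (x + Pi.single (0 : Fin 3) s) = G x) → (∀ x, G x 0 = 0) →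
      IsDivFree G →
      IsGlobalLerayHopf ν (fun _ => fun x => Φ x • G x) u₀ u →
      (∃ C : ℝ, ∀ t : ℝ, 0 ≤ t → kineticEnergy (u t) ≤ C) →
      c * Λ.longTimeAvg (fun t => ∫ x, ⟪partialDeriv 0 ρ x • G x, u t x⟫) +
        Λ.longTimeAvg (fun t => ∫ x, ⟪u t x - c • EuclideanSpace.single 0 1,
          convect (fun y => u t y - c • EuclideanSpace.single 0 1) (fun y => ρ y • G y) x⟫) +
        ν * Λ.longTimeAvg (fun t => ∫ x, ⟪u t x, laplacian (fun y => ρ y • G y) x⟫) +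
        ∫ x, Φ x * ρ x * ‖G x‖ ^ 2 = 0 := by
  intro Λ ν c Φ ρ G u₀ u hν hΦ hρ hG hρinv hGinv hG0 hdivG hu hE
  -- the design: `F = Φ•G` (force), `V = ρ•G` (test field), `θ = ∂₀ρ`
  have hFs : IsSmooth (fun x => Φ x • G x) := hΦ.smul' hG
  have hF : MemLp (fun x => Φ x • G x) 2 volume := hFs.memLp 2
  have hV : IsSmooth (fun x => ρ x • G x) := hρ.smul' hG
  have hVdiv : IsDivFree (fun x => ρ x • G x) :=
    GridInjection.isDivFree_smul_of_design hρ hG hρinv hG0 hdivG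
  have hV0 : ∀ y, (ρ y • G y) 0 = 0 := fun y => by simp [hG0 y]
  have hdV : ∀ y, Torus.partialDeriv 0 (fun y => ρ y • G y) y = partialDeriv 0 ρ y • G y := by
    intro y
    rw [partialDeriv_smul (hρ.isContDiff (by simp)) (hG.isContDiff (by simp)),
      GridInjection.partialDeriv_eq_zero_of_forall_add_single hGinv y, smul_zero, zero_add]
  have hθc : Continuous (partialDeriv 0 ρ) := (hρ.partialDeriv 0).continuous
  have hmem : ∀ t : ℝ, 0 ≤ t → MemLp (u t) 2 volume := fun t ht =>
    (hu (t + 1) (by linarith)).memLp t ⟨ht, by linarith⟩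
  -- the mean momentum balance (item stmt-AnomalousDissipation-1773) at the test field `ρ•G`
  have hMV := meanMomentumBalance_proof Λ ν (fun x => Φ x • G x) (fun x => ρ x • G x) u₀ u hν hFs hV
    hVdiv hu hE
  -- the force pairing
  have hFV : ∫ x, ⟪Φ x • G x, ρ x • G x⟫ = ∫ x, Φ x * ρ x * ‖G x‖ ^ 2 := by
    refine integral_congr_ae (ae_of_all _ fun x => ?_)
    simp only [real_inner_smul_left, real_inner_smul_right, real_inner_self_eq_norm_sq]
    ring
  -- interval integrability of the imprint pairing `t ↦ (∂₀ρ•G, u t)`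
  have hB : ∀ T, 0 < T →
      IntervalIntegrable (fun t => ∫ x, ⟪partialDeriv 0 ρ x • G x, u t x⟫) volume 0 T := by
    intro T hT
    have h := GridInjection.intervalIntegrable_inner hu (hθc.smul hG.continuous) hT
    refine (h.congr fun t _ => ?_)
    exact integral_congr_ae (ae_of_all _ fun x => real_inner_comm _ _)
  -- the pointwise-in-time split of the convective pairing, `t ≥ 0`
  have h1 : ∀ t : ℝ, 0 ≤ t → (∫ x, ⟪u t x, Torus.convect (u t) (fun y => ρ y • G y) x⟫) =
      (∫ x, ⟪u t x - c • EuclideanSpace.single 0 1,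
        Torus.convect (fun y => u t y - c • EuclideanSpace.single 0 1) (fun y => ρ y • G y) x⟫) +
        c * ∫ x, ⟪partialDeriv 0 ρ x • G x, u t x⟫ := by
    intro t ht
    rw [GridInjection.integral_inner_convect_eq_shift hV hG.continuous hθc hV0 hG0 hdV c (hmem t ht)]
    congr 2
    refine integral_congr_ae (ae_of_all _ fun x => ?_)
    show partialDeriv 0 ρ x * ⟪u t x, G x⟫ = ⟪partialDeriv 0 ρ x • G x, u t x⟫
    rw [real_inner_smul_left, real_inner_comm (G x) (u t x)]
  -- interval integrability of the shifted convective pairing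
  have hA : ∀ T, 0 < T → IntervalIntegrable (fun t => ∫ x, ⟪u t x - c • EuclideanSpace.single 0 1,
      Torus.convect (fun y => u t y - c • EuclideanSpace.single 0 1) (fun y => ρ y • G y) x⟫)
      volume 0 T := by
    intro T hT
    have h := (GridInjection.intervalIntegrable_inner_convect hF hu hV hT).sub ((hB T hT).const_mul c)
    refine h.congr fun t ht => ?_
    rw [uIoc_of_le hT.le] at ht
    show (∫ x, ⟪u t x, Torus.convect (u t) (fun y => ρ y • G y) x⟫) -
      c * (∫ x, ⟪partialDeriv 0 ρ x • G x, u t x⟫) = _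
    rw [h1 t ht.1.le]
    ring
  -- linearity of the generalized long-time average
  have hsplit : Λ.longTimeAvg (fun t => ∫ x, ⟪u t x, Torus.convect (u t) (fun y => ρ y • G y) x⟫) =
      Λ.longTimeAvg (fun t => ∫ x, ⟪u t x - c • EuclideanSpace.single 0 1,
        Torus.convect (fun y => u t y - c • EuclideanSpace.single 0 1) (fun y => ρ y • G y) x⟫) +
        c * Λ.longTimeAvg (fun t => ∫ x, ⟪partialDeriv 0 ρ x • G x, u t x⟫) := by
    rw [Λ.longTimeAvg_congr (fun t ht => h1 t ht.le),
      GridInjection.longTimeAvg_add Λ hA (fun T hT => (hB T hT).const_mul c),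
      GridInjection.longTimeAvg_const_mul]
  rw [hsplit, hFV] at hMV
  linarith

end Summit.AnomalousDissipation.AnomalousDissipation.Theorems

end
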